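import Summits.KontsevichZagierPeriods.Zeta5Search.LaiSweepShard

/-!
# `κ₃` sweep certificate — shard file 065 of 127 (shards 455–461 of 889)

HONEST FRAMING. Systematic search; no irrationality claim unless certified. This file only checks,
by `decide +kernel`, shards 455–461 of the order-cell sweep of the `κ₃` point `(74, 2180, 444; δ74)`
(engine `LaiSweepEngine`, soundness `LaiSweepJump/Free/Eval/Shard/Kappa3`; a shard is `⟨regime, n,
p, q, p', q', Lo, Up⟩`: `n` cells from `p/q` to `p'/q'` with integer rate sums in `[Lo, Up]`, `K =
128`, `D = 2^40`). It draws NO conclusion: only the capstone `LaiKappa3SweepCert`, which needs all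
127 shard files, does. Kernel cost of this file ≈ 560 cells × 0.3 s.
-/

namespace Summit.KontsevichZagierPeriods.Zeta5Search.Sweep

set_option maxHeartbeats 100000000 in
/-- Shard 455: 80 cells of regime B from `149/328` to `77/169`.
[cite: Lai2024BallRivoal, §4 Lemma 4.3] -/
theorem shard455 :
    Shard.check 128 (2^40)
      ⟨true, 80, 149, 328, 77, 169, 17354289839574, 20451585661268⟩ = true := by
  decide +kernel

set_option maxHeartbeats 100000000 in
/-- Shard 456: 80 cells of regime B from `77/169` to `53/116`.
[cite: Lai2024BallRivoal, §4 Lemma 4.3] -/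
theorem shard456 :
    Shard.check 128 (2^40)
      ⟨true, 80, 77, 169, 53, 116, 16341056422869, 19274780166079⟩ = true := by
  decide +kernel

set_option maxHeartbeats 100000000 in
/-- Shard 457: 80 cells of regime B from `53/116` to `175/382`.
[cite: Lai2024BallRivoal, §4 Lemma 4.3] -/
theorem shard457 :
    Shard.check 128 (2^40)
      ⟨true, 80, 53, 116, 175, 382, 15575867675179, 18388493092142⟩ = true := by
  decide +kernel

set_option maxHeartbeats 100000000 in
/-- Shard 458: 80 cells of regime B from `175/382` to `181/394`.
[cite: Lai2024BallRivoal, §4 Lemma 4.3] -/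
theorem shard458 :
    Shard.check 128 (2^40)
      ⟨true, 80, 175, 382, 181, 394, 16284563937341, 19242407721714⟩ = true := by
  decide +kernel

set_option maxHeartbeats 100000000 in
/-- Shard 459: 80 cells of regime B from `181/394` to `199/432`.
[cite: Lai2024BallRivoal, §4 Lemma 4.3] -/
theorem shard459 :
    Shard.check 128 (2^40)
      ⟨true, 80, 181, 394, 199, 432, 15991657783205, 18913280188816⟩ = true := by
  decide +kernel

set_option maxHeartbeats 100000000 in
/-- Shard 460: 80 cells of regime B from `199/432` to `176/381`.
[cite: Lai2024BallRivoal, §4 Lemma 4.3] -/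
theorem shard460 :
    Shard.check 128 (2^40)
      ⟨true, 80, 199, 432, 176, 381, 16435548109988, 19456669695013⟩ = true := by
  decide +kernel

set_option maxHeartbeats 100000000 in
/-- Shard 461: 80 cells of regime B from `176/381` to `44/95`.
[cite: Lai2024BallRivoal, §4 Lemma 4.3] -/
theorem shard461 :
    Shard.check 128 (2^40)
      ⟨true, 80, 176, 381, 44, 95, 15403180819054, 18250188772896⟩ = true := by
  decide +kernel

/-- The checked shards of this file, in order. [folklore] -/
def shards065 : List (CheckedShard 128 (2^40)) :=
  [⟨_, shard455⟩, ⟨_, shard456⟩, ⟨_, shard457⟩, ⟨_, shard458⟩, ⟨_, shard459⟩,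
    ⟨_, shard460⟩, ⟨_, shard461⟩]

end Summit.KontsevichZagierPeriods.Zeta5Search.Sweep
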